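import Mathlib
import Literature.NumberTheory.Automorphic.HilbertModularFormQExpansion
import Summits.Langlands.Langlands.Theorems.CapacityClassicalityHilbertIntegralOverconvergentIsCongruenceStubQIndexEncoding
import Summits.Langlands.Langlands.Theorems.CapacityClassicalityHilbertIntegralOverconvergentIsCongruenceStubTraceEncodingInjective
import Summits.Langlands.Langlands.Theorems.CapacityClassicalityHilbertIntegralOverconvergentIsCongruenceStubTracePosOfTotallyPositive
import Summits.Langlands.Langlands.Theorems.CapacityClassicalityHilbertIntegralOverconvergentIsCongruenceStubTotallyPositiveIntegralBasis

/-!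
# The trace-basis encoding of the `q`-index cone with its trace formula

Stub `stub_qIndex_encoding_trace` (R1) for line Sketch-ideate-r1-k1 of the crux
`HilbertIntegralOverconvergentIsCongruence` (stmt-Langlands-8485).  The encoding of the cone
`qIndexSet F` of Hilbert `q`-expansion indices into `ℕ^d`, `d = [F:ℚ]`, of the landed stub
`stub_qIndex_encoding` — `ν ↦ (Tr_{F/ℚ}(β_j ν))_j` for a `ℚ`-basis `β` of totally positive
algebraic integers (landed `stub_exists_totallyPositive_integralBasis`) — is re-run here with its
TRACE FORMULA exposed: its total degree is `∑_j Tr(β_j ν) = Tr(α ν)` for the totally positive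
algebraic integer `α := ∑_j β_j` (the index type `Fin d` is nonempty as `d = finrank ≥ 1`), so the
engine's weight "total degree" reads the Sturm trace window `{Tr(α ν) < L}`.  Injectivity and
additivity on the cone are proved exactly as in the landed file, through its helper lemmas
`enc_cast_idx` (each coordinate, cast to `ℚ`, is the trace) and `enc_add_mem_qIndexSet`.
-/

set_option linter.dupNamespace false

noncomputable section

namespace Summit.Langlands.Langlands.Theorems.HilbertIntegralOverconvergentIsCongruence

open NumberField
open Literature.NumberTheory.Automorphic Literature.NumberTheory.Automorphic.HilbertModular

/-- A finite sum of totally positive algebraic integers over a nonempty index type is totally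
positive. -/
theorem ect_sum_totallyPositive (F : Type*) [Field F] [NumberField F] {ι : Type*} [Fintype ι]
    [Nonempty ι] (β : ι → 𝓞 F) (hpos : ∀ j (τ : F →+* ℝ), 0 < τ (β j)) (σ : F →+* ℝ) :
    0 < σ ((∑ j, β j : 𝓞 F) : F) := by
  rw [show ((∑ j, β j : 𝓞 F) : F) = ∑ j, (β j : F) from map_sum (algebraMap (𝓞 F) F) _ _,
    map_sum]
  exact Finset.sum_pos (fun j _ ↦ hpos j σ) Finset.univ_nonempty

/-- The trace formula for the trace-basis encoding: on the cone, the sum of the coordinates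
`⌊Tr(β_j ν)⌋.toNat`, cast to `ℚ`, is `Tr((∑_j β_j) ν)`. -/
theorem ect_sum_idx_eq_trace (F : Type*) [Field F] [NumberField F] [NumberField.IsTotallyReal F]
    {ι : Type*} [Fintype ι] (β : ι → 𝓞 F) (hpos : ∀ j (τ : F →+* ℝ), 0 < τ (β j)) {ν : F}
    (hν : ν ∈ qIndexSet F) :
    ((∑ j, ⌊Algebra.trace ℚ F ((β j : F) * ν)⌋.toNat : ℕ) : ℚ) =
      Algebra.trace ℚ F (((∑ j, β j : 𝓞 F) : F) * ν) := by
  rw [show ((∑ j, β j : 𝓞 F) : F) = ∑ j, (β j : F) from map_sum (algebraMap (𝓞 F) F) _ _,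
    Finset.sum_mul, map_sum, Nat.cast_sum]
  exact Finset.sum_congr rfl fun j _ ↦ enc_cast_idx F hν (β j) (hpos j)

/-- **stub R1 — `stub_qIndex_encoding_trace`.** The trace-basis encoding of § O with its TRACE
FORMULA exposed: for a `ℚ`-basis `β` of totally positive algebraic integers (landed S13a),
`idx ν := (Tr(β_j ν))_j` is injective and additive on the cone and its total degree is `Tr(αν)`
for the totally positive integer `α := ∑_j β_j` — so the engine's weight `wt := total degree`
reads the Sturm trace window `{Tr(αν) < L}`. [folklore] -/
theorem stub_qIndex_encoding_trace (F : Type) [Field F] [NumberField F] [NumberField.IsTotallyReal F] :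
    ∃ (d : ℕ) (idx : F → (Fin d →₀ ℕ)) (α : 𝓞 F), (∀ σ : F →+* ℝ, 0 < σ (α : F)) ∧ Set.InjOn idx (qIndexSet F) ∧
      (∀ μ ∈ qIndexSet F, ∀ μ' ∈ qIndexSet F, idx (μ + μ') = idx μ + idx μ') ∧
      ∀ ν ∈ qIndexSet F, ((∑ j, idx ν j : ℕ) : ℚ) = Algebra.trace ℚ F ((α : F) * ν) := by
  classical
  obtain ⟨β, hli, hpos⟩ := stub_exists_totallyPositive_integralBasis F
  -- the index type `Fin d`, `d = [F:ℚ] ≥ 1`, is nonempty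
  haveI : Nonempty (Fin (Module.finrank ℚ F)) := ⟨⟨0, Module.finrank_pos⟩⟩
  refine ⟨Module.finrank ℚ F, fun μ ↦ Finsupp.equivFunOnFinite.symm
    fun j ↦ ⌊Algebra.trace ℚ F ((β j : F) * μ)⌋.toNat, ∑ j, β j,
    ect_sum_totallyPositive F β hpos, ?_, ?_, ?_⟩
  · -- injectivity on the cone: equal encodings give equal rational trace vectors
    intro μ hμ μ' hμ' h
    refine stub_traceEncodingInjective F (fun j ↦ (β j : F)) hli rfl (funext fun j ↦ ?_)
    have hj := congrArg (fun f : Fin (Module.finrank ℚ F) →₀ ℕ ↦ ((f j : ℕ) : ℚ)) h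
    simp only [Finsupp.coe_equivFunOnFinite_symm] at hj
    rwa [enc_cast_idx F hμ (β j) (hpos j), enc_cast_idx F hμ' (β j) (hpos j)] at hj
  · -- additivity on the cone: additivity of the trace
    intro μ hμ μ' hμ'
    ext j
    apply Nat.cast_injective (R := ℚ)
    simp only [Finsupp.add_apply, Finsupp.coe_equivFunOnFinite_symm, Nat.cast_add]
    rw [enc_cast_idx F hμ (β j) (hpos j), enc_cast_idx F hμ' (β j) (hpos j),
      enc_cast_idx F (enc_add_mem_qIndexSet F hμ hμ') (β j) (hpos j), mul_add, map_add]
  · -- the trace formula: `∑_j Tr(β_j ν) = Tr((∑_j β_j) ν)`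
    intro ν hν
    simp only [Finsupp.coe_equivFunOnFinite_symm]
    exact ect_sum_idx_eq_trace F β hpos hν

end Summit.Langlands.Langlands.Theorems.HilbertIntegralOverconvergentIsCongruence

end
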